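import Literature.MathematicalPhysics.QuantumFieldTheory.Balaban1983to89.Node00.TorusCoverLocalGauge10
import Literature.MathematicalPhysics.QuantumFieldTheory.Balaban1983to89.Node00.TorusCoverGaugeTokensR
import Literature.MathematicalPhysics.QuantumFieldTheory.Balaban1983to89.Node00.LocalGaugeCoDivergence

/-!
# NODE 00 — THE (152) STEP TOKEN CARRYING PRINT'S SECOND-ORDER LETTER: `Gauge152OfClassTopStepR10 F N Sup M c B₉ a₀` (FILE 29's `Gauge152OfClassTopStepR` binder block,
# conclusion 33b's `Sect2.LocalGauge10On □ η_n (B₉ε_n) U`), ITS BRIDGE FROM [6] PROPOSITION 6 AT NODE 00's `ℤᵈ` MEMBER, and BOTH halves of (2) on every grid cube of a class member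

Cell `pub-ymgap`, seat `pub-ymgap-dag-n07-e` generation 13 (R141 (C), DAG node N07 = [15]; cell INBOX INTENT-34 of 2026-08-27).  NEW leaf, DEFINITION kind (TWO `def`s, `Prop`s
with parameters, NEVER asserted); CONSUMED BY NAME, nothing modified: FILE 29 `Node00.TorusCoverGaugeTokensR` (`Gauge152OfClassTopStepR`, `b9Of`, `a0Of`, `a0Of_pos`,
`boxWidth_propCube`, `cover_image_Ω_cubeIdx'_one_subset_hullD`), FILE 26 (`cover_image_Ω_cubeIdx'_subset`, `propCube_M∕_k`), 34b `Node00.TorusCoverLocalGauge10`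
(`exists_localGauge10_cube_of_prop6`), 33b∕33c (`Sect2.LocalGauge10On`, `Sect2.LocalGauge10On.toLocalGaugeOn`, `Sect2.regularTwo_of_localGauge10On`), module 31
(`plaqSmallOn_of_localGaugeOn`), def-R's `suppDomOfRecord`.  `--supports stmt-QuantumFields-20541` (K0⁷).
[15] = [Balaban1985Variational]; [6] = [Balaban1985RegularSpaces]; [III] = [Balaban1988Convergent].

WHY.  FILE 29's (152) token `Gauge152OfClassTopStepR` concludes, on every non-wrapping grid cube `□ ⊆ Ω_n` of the two families, def-P11's clause `Sect2.LocalGaugeOn □ η_n (B₉ε_n) U` —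
[15] (152)'s `|A|, |∇A|`.  Print's (152) has two more members, `(L^jη)³|∂^{η*}∂^ηA|, (L^jη)³|Δ^ηA| < 9dL²B₁Mε₀` ([6] Thm 2 (1.36) ∕ Prop. 6 (1.136)), and the first of them is
what [15] (168)'s co-divergence clause consumes (33c `coDivSmallOn_of_localGauge10On`).  34a∕34b showed that N05's member sentence `B8.Prop6Printed … (zdCub (M_N ℂ) L ·)`
EXPORTS it through the torus cover with the same constant `2r`.  This file names the strengthened token — FILE 29's binder block BYTE FOR BYTE, conclusion 33b's
`Sect2.LocalGauge10On` (= `LocalGaugeOn` + `‖∂^{η_n*}∂^{η_n}A‖ < B₉ε_n` on the deep bonds of `□`) — proves it from the Proposition-6 slot with FILE 29's floor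
`(11·4 + 3L)·L ≤ M₁` and FILE 29's constants `b9Of`, `a0Of` UNCHANGED (the third letter costs nothing new), records `R10 ⇒ R`, and reads BOTH members of the class (2) back
on every grid cube: [6] Thm 2's gauge, read through [15] (168) ∕ [6] (1.54), returns (1.7) at `32B₉ε_n·η_n²` on `plaqInside □` (module 31) AND (1.9) at `2B₉ε_n·η_n³` on
`bondsDeep □` (33c) whenever `32·d·B₉ε_n ≤ 1` — the consistency loop «class ⇒ gauge ⇒ class» of [6] Thm 2 ∕ Prop. 7 at NODE 00's objects, both members.

CONTENTS.  §1 ★★ `Gauge152OfClassTopStepR10` (def), `Gauge152OfClassTopStepR10.toR` (⇒ FILE 29's token), `.of_le`, `.mono_floor`; ★★ `Gauge9RegSepTopStepR10` (def; FILE 29's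
(9)-step token with the second-order letter = [15] Thm 1 (9)–(10) for critical configurations), `.toR`, ★ `gauge9R10_of_prop8TopStep_of_gauge152R10` (⟸ V15 stub 1's fact
`Prop8RegSepTopStep` ∧ the (152) token, FILE 29's reduction verbatim).  §2 ★★★ `gauge152R10_of_prop6`
(`B8.Prop6Printed 4 L B₁ c₁ (zdCub (MatA N) L ·) → Gauge152OfClassTopStepR10 F N suppDomOfRecord M ((11·4+3L)L) (b9Of F M B₁) (a0Of F N M B₁ c₁)` — FILE 29's
`gauge152R_of_prop6` with 34b's four-letter push-down).  §3 ★ `regularTwo_cube_of_gauge152R10` (the token ⇒ (1.7) ∧ (1.9) on every grid cube).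

HONEST FRAMING: two displayed `Prop`s (never asserted) + a composition by name; [6] Proposition 6 at the member is the HYPOTHESIS `hP6` of §2 (N05's node; never asserted
here); nothing of Bałaban discharged; K0⁷ ∕ V15 stub 1 NOT closed (stub 1 = [15] Prop. 8's top step, untouched); N07 ∕ N05 NOT discharged; counts unmoved (5∕27); one finite
T⁴ programme at fixed ε — NOT continuum ∕ ℝ⁴ ∕ infinite volume ∕ OS ∕ mass gap ∕ Clay.  Two `def`s, no `instance`, no `notation`, no `sorry`.
-/

noncomputable section

namespace Literature.MathematicalPhysics.QuantumFieldTheory.Balaban1983to89.Node00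

open scoped Matrix.Norms.L2Operator
open T4Continuum (T4Family)
open B15DeterminingSets B12RegularSpaces111
open B15Eq112TorusCover (cover)
open B14DomainGeom (Pt)
open B14.Eq213MaximalDomains (side cubeExt)
open B7Prop1Explicit (e)
open B8Eq131Cubes (box tcube bLo bHi)
open B8LeafModelZd (ZdIdx)

/-! ## §1  ★★ The token with the second-order letter and its algebra -/

section Tokens

variable (F : T4Family) (N : ℕ) [NeZero N]

/-- ★★ **[15] (152) ∕ [6] THM 2 ON THE COLLARED CUBE FOR CLASS MEMBERS, WITH PRINT'S SECOND-ORDER LETTER** — FILE 29's `Gauge152OfClassTopStepR F N Sup M c B₉ a₀` binder block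
BYTE FOR BYTE (separated `s` with floor `c ≤ ν.M₁`, `1 ≤ k`, level radii `0 < ε_m ≤ a₀` two-sided 2-comparable, `U` in the (1.7)∕(1.9)-Top class, scale `1 ≤ n ≤ k`, the two
cube families of sides `side L M n` ∕ `side L M (n+1)`, non-wrapping, inside `Ω_n`), CONCLUSION 33b's clause `Sect2.LocalGauge10On □ η_n (B₉·ε_n) U`: an `SU(N)` gauge `u`
and a potential `A` on `□` with `(ι∘U)^{ι∘u} = e^{iη_nA}`, `‖A‖ < B₉ε_n` on the bonds, `‖∇^{η_n}A‖ < B₉ε_n` on the stencils AND `‖∂^{η_n*}∂^{η_n}A‖ < B₉ε_n` on the deep bonds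
of `□` — print's (152) «L^jη|A|, (L^jη)²|∇^ηA|, (L^jη)³|∂^{η*}∂^ηA|, … < 9dL²B₁Mε₀» minus the Laplacian member.  A `Prop`, NEVER asserted.
[cite: Balaban1985Variational, (144)–(152) pp.300–301, Thm 1 (9)–(10) p.279; Balaban1985RegularSpaces, Thm 2 (1.36) pp.82–83, Prop. 6 (1.136) p.99, (1.3)–(1.6) p.77; Balaban1988Convergent, (2.13) p.256] -/
def Gauge152OfClassTopStepR10 (Sup : (ν : Stage7Numerics) → (K : ℕ) → (ℕ → Set (Site (F.P K) 0)) → Set (Site (F.P K) 0)) (M c : ℕ) (B₉ a₀ : ℝ) : Prop :=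
  ∀ (ν : Stage7Numerics) (g : ℕ → ℝ) (K k : ℕ) (s : SeqOfRecord F ν M g K k), Sect2.SeqSeparated ν.M₁ s → 0 < ν.M₁ → c ≤ ν.M₁ → 1 ≤ k →
    ∀ (ε : ℕ → ℝ),
    (∀ m, m ≤ k → 0 < ε m ∧ ε m ≤ a₀) → (∀ m, m < k → ε m ≤ 2 * ε (m + 1)) → (∀ m, m < k → ε (m + 1) ≤ 2 * ε m) →
      ∀ U : GaugeField (F.P K) 0 (SU N),
        (∀ m, m ≤ k → PlaqSmallOn (Sect2.omegaPlaqsTop s.Ω (Sup ν K s.Ω) m) (ε m * (F.P K).eta m ^ 2) U) →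
        (∀ m, m ≤ k → Sect2.CoDivSmallOn (Sect2.omegaBondsTop s.Ω (Sup ν K s.Ω) m) (ε m * (F.P K).eta m ^ 3) U) →
        ∀ n, 1 ≤ n → n ≤ k → ∀ S : ℕ,
          (S = B14.Eq213MaximalDomains.side (F.P K).L M n ∨ S = B14.Eq213MaximalDomains.side (F.P K).L M (n + 1)) → (S : ℤ) < (F.P K).sitesPerDir 0 →
          ∀ a ∈ cubeIndices (F.P K) S, cubeEnl (F.P K) S a 0 ⊆ s.Ω n →
            Sect2.LocalGauge10On (cubeEnl (F.P K) S a 0) ((F.P K).eta n) (B₉ * ε n) U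

variable {F N}

/-- NEW ⇒ OLD: forgetting the second-order letter gives FILE 29's token (33b's `LocalGauge10On.toLocalGaugeOn`). [cite: Balaban1985Variational, (152) p.301 (bookkeeping)] -/
theorem Gauge152OfClassTopStepR10.toR {Sup : (ν : Stage7Numerics) → (K : ℕ) → (ℕ → Set (Site (F.P K) 0)) → Set (Site (F.P K) 0)} {M c : ℕ} {B₉ a₀ : ℝ}
    (h : Gauge152OfClassTopStepR10 F N Sup M c B₉ a₀) : Gauge152OfClassTopStepR F N Sup M c B₉ a₀ :=
  fun ν g K k s hsep hM₁ hc hk ε hε hcomp hcomp' U hP hD n hn1 hnk S hS hSN a ha hΩ =>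
    (h ν g K k s hsep hM₁ hc hk ε hε hcomp hcomp' U hP hD n hn1 hnk S hS hSN a ha hΩ).toLocalGaugeOn

/-- The token is ANTITONE in the ceiling `a₀`. [cite: Balaban1985Variational, (152) p.301 («9dL²Mε₀ ≦ c₁»; bookkeeping)] -/
theorem Gauge152OfClassTopStepR10.of_le {Sup : (ν : Stage7Numerics) → (K : ℕ) → (ℕ → Set (Site (F.P K) 0)) → Set (Site (F.P K) 0)} {M c : ℕ} {B₉ a₀ a₀' : ℝ}
    (h : Gauge152OfClassTopStepR10 F N Sup M c B₉ a₀) (ha₀ : a₀' ≤ a₀) : Gauge152OfClassTopStepR10 F N Sup M c B₉ a₀' :=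
  fun ν g K k s hsep hM₁ hc hk ε hε hcomp hcomp' U h17 h19 =>
    h ν g K k s hsep hM₁ hc hk ε (fun m hm => ⟨(hε m hm).1, (hε m hm).2.trans ha₀⟩) hcomp hcomp' U h17 h19

/-- The token is MONOTONE in the floor. [cite: Balaban1985RegularSpaces, (1.3)–(1.6) p.77 (bookkeeping)] -/
theorem Gauge152OfClassTopStepR10.mono_floor {Sup : (ν : Stage7Numerics) → (K : ℕ) → (ℕ → Set (Site (F.P K) 0)) → Set (Site (F.P K) 0)} {M c c' : ℕ} {B₉ a₀ : ℝ}
    (h : Gauge152OfClassTopStepR10 F N Sup M c B₉ a₀) (hc : c ≤ c') : Gauge152OfClassTopStepR10 F N Sup M c' B₉ a₀ :=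
  fun ν g K k s hsep hM₁ hc' hk => h ν g K k s hsep hM₁ (hc.trans hc') hk

variable (F N) in
/-- ★★ **[15] THM 1 (9)–(10) FOR CRITICAL CONFIGURATIONS, WITH THE SECOND-ORDER LETTER** — FILE 29's `Gauge9RegSepTopStepR F N Sup M c B₃ B₃' a₀ a₁` binder block BYTE FOR
BYTE (separated `s` with floor `c ≤ ν.M₁`, `1 ≤ k`, thresholds `0 < δ_n ≤ a₁`, `B₃δ_n ≤ ε₀ ≤ a₀`, two-sided 2-comparable, a (7)-regular datum `W`, a configuration `U` in the
(1.7)∕(1.9)-Top class at `ε₀` on the fibre of `W`, CRITICAL on the fibre), CONCLUSION 33b's clause `Sect2.LocalGauge10On □ η_n (B₃'·δ_n) U` on every non-wrapping grid cube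
`□ ⊆ Ω_n` of the two families — print's (9) line 1 AND (10)'s first member «|∂^{η*}∂^ηA| < B₃Mε₁(L^jη)⁻³» in the record's letters (no Hölder member, no Laplacian member).
A `Prop`, NEVER asserted. [cite: Balaban1985Variational, Thm 1 (9)–(10) p.279, Sect. F pp.300–305; Balaban1985RegularSpaces, (1.3)–(1.6) p.77; Balaban1988Convergent, (2.13) p.256] -/
def Gauge9RegSepTopStepR10 (Sup : (ν : Stage7Numerics) → (K : ℕ) → (ℕ → Set (Site (F.P K) 0)) → Set (Site (F.P K) 0)) (M c : ℕ) (B₃ B₃' a₀ a₁ : ℝ) : Prop :=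
  ∀ (ν : Stage7Numerics) (g : ℕ → ℝ) (K k : ℕ) (s : SeqOfRecord F ν M g K k), Sect2.SeqSeparated ν.M₁ s → 0 < ν.M₁ → c ≤ ν.M₁ → 1 ≤ k →
    ∀ (ε₀ : ℝ) (δ : ℕ → ℝ),
    (∀ n, n ≤ k → 0 < δ n ∧ δ n ≤ a₁ ∧ B₃ * δ n ≤ ε₀) → (∀ n, n < k → δ n ≤ 2 * δ (n + 1)) → (∀ n, n < k → δ (n + 1) ≤ 2 * δ n) → ε₀ ≤ a₀ →
    ∀ W : MSField (F.P K) (SU N), Sect2.DataSmall7PTop (avOfRecord F N K) s.Ω (Sup ν K s.Ω) k δ W →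
      ∀ U : GaugeField (F.P K) 0 (SU N),
        (∀ n, n ≤ k → PlaqSmallOn (Sect2.omegaPlaqsTop s.Ω (Sup ν K s.Ω) n) (ε₀ * (F.P K).eta n ^ 2) U) →
        Sect2.CoDivClassOnTop s.Ω (Sup ν K s.Ω) k ε₀ U → AgreeOn (genSet s.Ω k) (avgFamily (avOfRecord F N K) U) W →
        IsCritOnFibre F N K (genSet s.Ω k) W U →
        ∀ n, 1 ≤ n → n ≤ k → ∀ S : ℕ,
          (S = B14.Eq213MaximalDomains.side (F.P K).L M n ∨ S = B14.Eq213MaximalDomains.side (F.P K).L M (n + 1)) → (S : ℤ) < (F.P K).sitesPerDir 0 →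
          ∀ a ∈ cubeIndices (F.P K) S, cubeEnl (F.P K) S a 0 ⊆ s.Ω n →
            Sect2.LocalGauge10On (cubeEnl (F.P K) S a 0) ((F.P K).eta n) (B₃' * δ n) U

/-- NEW ⇒ OLD for the (9)-step token. [cite: Balaban1985Variational, Thm 1 (9) p.279 (bookkeeping)] -/
theorem Gauge9RegSepTopStepR10.toR {Sup : (ν : Stage7Numerics) → (K : ℕ) → (ℕ → Set (Site (F.P K) 0)) → Set (Site (F.P K) 0)} {M c : ℕ} {B₃ B₃' a₀ a₁ : ℝ}
    (h : Gauge9RegSepTopStepR10 F N Sup M c B₃ B₃' a₀ a₁) : Gauge9RegSepTopStepR F N Sup M c B₃ B₃' a₀ a₁ :=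
  fun ν g K k s hsep hM₁ hc hk ε₀ δ hδ hcomp hcomp' hε₀ W h7 U h17 h19 hfib hcrit n hn1 hnk S hS hSN a ha hΩ =>
    (h ν g K k s hsep hM₁ hc hk ε₀ δ hδ hcomp hcomp' hε₀ W h7 U h17 h19 hfib hcrit n hn1 hnk S hS hSN a ha hΩ).toLocalGaugeOn

/-- ★ **THE REDUCTION WITH THE SECOND-ORDER LETTER** (FILE 29's `gauge9R_of_prop8TopStep_of_gauge152R`, verbatim otherwise): [15] Thm 1 (9) line 1 + (10)'s first member for
critical configurations ⟸ [15] Prop. 8's top step (V15 stub 1's fact) ∧ the (152) token with the second-order letter (§2: from [6] Prop. 6 at the member) — apply the token at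
the radii `B₃δ_•` of (8). [cite: Balaban1985Variational, Sect. F pp.300–305, Prop. 8 p.304, (152) p.301, Thm 1 (8)–(10) p.279] -/
theorem gauge9R10_of_prop8TopStep_of_gauge152R10
    {Sup : (ν : Stage7Numerics) → (K : ℕ) → (ℕ → Set (Site (F.P K) 0)) → Set (Site (F.P K) 0)} {M c : ℕ} {B₃ B₉ a₀ a₀' a₁ : ℝ}
    (h8 : Prop8RegSepTopStep F N Sup B₃ a₀ a₁) (h152 : Gauge152OfClassTopStepR10 F N Sup M c B₉ a₀') (hB₃ : 0 < B₃) (ha : B₃ * a₁ ≤ a₀') :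
    Gauge9RegSepTopStepR10 F N Sup M c B₃ (B₉ * B₃) a₀ a₁ := by
  intro ν g K k s hsep hM₁ hc hk ε₀ δ hδ hcomp hcomp' hε₀ W h7 U h17 h19 hfib hcrit n hn1 hnk S hS hSN a ha' hΩ
  obtain ⟨h8p, h8c⟩ := h8 ν M g K k s hsep hM₁ hk ε₀ δ hδ hcomp hcomp' hε₀ W h7 U h17 h19 hfib hcrit
  have hε : ∀ m, m ≤ k → 0 < B₃ * δ m ∧ B₃ * δ m ≤ a₀' := fun m hm =>
    ⟨mul_pos hB₃ (hδ m hm).1, (mul_le_mul_of_nonneg_left (hδ m hm).2.1 hB₃.le).trans ha⟩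
  have hc1 : ∀ m, m < k → B₃ * δ m ≤ 2 * (B₃ * δ (m + 1)) := fun m hm => by
    have := mul_le_mul_of_nonneg_left (hcomp m hm) hB₃.le; linarith
  have hc2 : ∀ m, m < k → B₃ * δ (m + 1) ≤ 2 * (B₃ * δ m) := fun m hm => by
    have := mul_le_mul_of_nonneg_left (hcomp' m hm) hB₃.le; linarith
  have h := h152 ν g K k s hsep hM₁ hc hk (fun m => B₃ * δ m) hε hc1 hc2 U h8p h8c n hn1 hnk S hS hSN a ha' hΩ
  rw [show B₉ * B₃ * δ n = B₉ * (B₃ * δ n) by ring]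
  exact h

end Tokens

/-! ## §2  ★★★ The token from [6] Proposition 6 at NODE 00's `ℤᵈ` member (FILE 29's wrapper with 34b's four-letter push-down) -/

section Wrapper

variable {F : T4Family} {N : ℕ} [NeZero N]

/-- ★★★ **`Gauge152OfClassTopStepR10 … suppDomOfRecord M ((11·4+3L)·L) (b9Of F M B₁) (a0Of F N M B₁ c₁) ⟸ [6] PROP. 6 AT THE MEMBER`** — FILE 29's `gauge152R_of_prop6`
VERBATIM (the empty cube at `M = 0`; the generic cube letter `M₀ ∈ {M, LM}` at scale `n`: the collar clause from `Sect2.SeqSeparated` ∕ the hull at `n = 1` under the floor,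
print's «7dL²M′α₀ ≤ c₁» and the `2π`-window from `ε_{n−1} ≤ a0Of`, the letters at `2r < b9Of·ε_n` from `ε_{n−1} ≤ 2ε_n`) with 34b's `exists_localGauge10_cube_of_prop6`
supplying the FOURTH letter at the same `2r`.  Prop. 6 at the member is the HYPOTHESIS `hP6` (N05's node).
[cite: Balaban1985Variational, (144)–(152) pp.300–301, Thm 1 (10) p.279; Balaban1985RegularSpaces, Prop. 6 (1.135)–(1.136) p.99; Balaban1988Convergent, (2.13) p.256] -/
theorem gauge152R10_of_prop6 {B₁ c₁ : ℝ} (hB₁ : 0 ≤ B₁) (hc₁ : 0 < c₁)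
    (hP6 : letI : CStarAlgebra (MatA N) := {}; B8.Prop6Printed 4 (F.L : ℝ) B₁ c₁ (fun i : ZdIdx 4 F.L => zdCub (MatA N) F.L i)) (M : ℕ) :
    Gauge152OfClassTopStepR10 F N (fun ν K Ω => suppDomOfRecord F ν K Ω) M ((11 * 4 + 3 * F.L) * F.L) (b9Of F M B₁) (a0Of F N M B₁ c₁) := by
  intro ν g K k s hsep hM₁ hfloor hk ε hε hcomp hcomp' U h17 h19 n hn1 hnk S hS hSN a _ hΩ
  have hL2 : 2 ≤ F.L := (F.P 0).hL.2
  have hL : (1 : ℝ) ≤ F.L := by exact_mod_cast (F.P 0).L_pos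
  have hd : 2 ≤ (F.P K).d := by rw [T4Family.P_d]; norm_num
  have hNr : (1 : ℝ) ≤ N := by exact_mod_cast NeZero.pos N
  set M₂ : ℕ := F.L * M + 44 + F.L with hM₂
  have ha₀ := a0Of_pos (F := F) (N := N) M hB₁ hc₁
  -- the case `M = 0`: the cube is empty
  rcases Nat.eq_zero_or_pos M with hM0 | hMpos
  · subst hM0
    have hS0 : S = 0 := by rcases hS with h | h <;> simp [h, side]
    subst hS0
    have hempty : ∀ y, y ∉ cubeEnl (F.P K) 0 a 0 := by
      rintro y ⟨z, hz, -⟩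
      have h0 := hz ⟨0, by rw [T4Family.P_d]; norm_num⟩
      simp only [Nat.cast_zero, zero_mul, sub_zero, add_zero] at h0
      omega
    exact ⟨fun _ => 1, fun _ => 0, fun b hb => (hempty _ hb.1).elim, fun b hb => (hempty _ hb.1).elim, fun q hq => (hempty _ hq.1).elim,
      fun b hb => (hempty _ hb.1).elim⟩
  -- the generic cube letter `M₀ ∈ {M, LM}` at scale `n`
  have key : ∀ M₀ : ℕ, 1 ≤ M₀ → M₀ + 44 + F.L ≤ M₂ → ((side (F.P K).L M₀ n : ℕ) : ℤ) < (F.P K).sitesPerDir 0 →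
      cubeEnl (F.P K) (side (F.P K).L M₀ n) a 0 ⊆ s.Ω n →
      Sect2.LocalGauge10On (cubeEnl (F.P K) (side (F.P K).L M₀ n) a 0) ((F.P K).eta n) (b9Of F M B₁ * ε n) U := by
    intro M₀ hM₀ hM₀' hSN₀ hΩ₀
    have hεn1 : 0 < ε (n - 1) := (hε (n - 1) (by omega)).1
    have hεn1a : ε (n - 1) ≤ a0Of F N M B₁ c₁ := (hε (n - 1) (by omega)).2
    have hεn : 0 < ε n := (hε n hnk).1
    have hε2 : ε (n - 1) ≤ 2 * ε n := by
      have := hcomp (n - 1) (by omega)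
      rwa [show n - 1 + 1 = n by omega] at this
    have hM₀r : ((M₀ + 11 * 4 + F.L : ℕ) : ℝ) ≤ (M₂ : ℝ) := by exact_mod_cast (by omega : M₀ + 11 * 4 + F.L ≤ M₂)
    have hM₂pos : (0 : ℝ) < M₂ := by positivity
    have hM₀pos : (0 : ℝ) < ((M₀ + 11 * 4 + F.L : ℕ) : ℝ) := by positivity
    -- the collar clause
    have hcollar : cover (F.P K) '' (cubeIdx' (F.P K) n hn1 M₀ a).Ω 0 ⊆
        (if n - 1 = 0 then suppDomOfRecord F ν K s.Ω else s.Ω (n - 1)) := by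
      rcases Nat.eq_or_lt_of_le hn1 with h1 | h1
      · subst h1
        rw [if_pos rfl, suppDomOfRecord_eq]
        exact cover_image_Ω_cubeIdx'_one_subset_hullD (by rw [T4Family.P_d, T4Family.P_L]; exact hfloor) hM₀ a hΩ₀ 0
      · rw [if_neg (by omega)]
        refine cover_image_Ω_cubeIdx'_subset (F.P K) s hsep ?_ h1 hnk hM₀ a hΩ₀ 0
        rw [T4Family.P_d, T4Family.P_L]
        exact le_trans (Nat.le_mul_of_pos_right _ (F.P 0).L_pos) hfloor
    -- the smallness «7dL²M′α₀ ≤ c₁»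
    have ha₀c : a0Of F N M B₁ c₁ ≤ c₁ / (56 * (F.L : ℝ) ^ 5 * M₂) := by rw [hM₂]; exact min_le_left _ _
    have ha₀w : a0Of F N M B₁ c₁ ≤ 1 / (8 * (M₂ : ℝ) * N * (28 * (F.L : ℝ) ^ 5 * B₁ * M₂) + 1) := by rw [hM₂]; exact min_le_right _ _
    have hc₁' : 7 * (F.P K).d * ((F.P K).L : ℝ) ^ 2 * (propCube (F.P K) n hn1 M₀ a).M * (((F.P K).L : ℝ) ^ 3 * ε (n - 1)) ≤ c₁ := by
      rw [propCube_M, T4Family.P_d, T4Family.P_L]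
      have h1 : 7 * (4 : ℕ) * (F.L : ℝ) ^ 2 * ((M₀ + 11 * 4 + F.L : ℕ) : ℝ) * ((F.L : ℝ) ^ 3 * ε (n - 1)) ≤ 28 * (F.L : ℝ) ^ 5 * M₂ * a0Of F N M B₁ c₁ := by
        have : 7 * (4 : ℕ) * (F.L : ℝ) ^ 2 * ((M₀ + 11 * 4 + F.L : ℕ) : ℝ) * ((F.L : ℝ) ^ 3 * ε (n - 1)) =
            28 * (F.L : ℝ) ^ 5 * ((M₀ + 11 * 4 + F.L : ℕ) : ℝ) * ε (n - 1) := by push_cast; ring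
        rw [this]; gcongr
      have h2 : 28 * (F.L : ℝ) ^ 5 * M₂ * a0Of F N M B₁ c₁ ≤ 28 * (F.L : ℝ) ^ 5 * M₂ * (c₁ / (56 * (F.L : ℝ) ^ 5 * M₂)) :=
        mul_le_mul_of_nonneg_left ha₀c (by positivity)
      have h3 : 28 * (F.L : ℝ) ^ 5 * M₂ * (c₁ / (56 * (F.L : ℝ) ^ 5 * M₂)) = c₁ / 2 := by field_simp; ring
      linarith
    -- the `2π`-window of the normalisation
    have h2π : (2 * boxWidth (bLo (F.P K).L (propCube (F.P K) n hn1 M₀ a).a (propCube (F.P K) n hn1 M₀ a).k 0)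
        (bHi (F.P K).L (propCube (F.P K) n hn1 M₀ a).a (propCube (F.P K) n hn1 M₀ a).M (propCube (F.P K) n hn1 M₀ a).k 0) + 1) *
        ((F.P K).eta n * N * (7 * (F.P K).d * ((F.P K).L : ℝ) ^ 2 * B₁ * (propCube (F.P K) n hn1 M₀ a).M * (((F.P K).L : ℝ) ^ 3 * ε (n - 1)) *
          (((F.P K).L : ℝ) ^ (propCube (F.P K) n hn1 M₀ a).k * (F.P K).eta n)⁻¹)) < 2 * Real.pi := by
      rw [boxWidth_propCube, propCube_M, propCube_k, B12Eq115BackgroundPair.pow_mul_eta, inv_one, mul_one, T4Family.P_d, T4Family.P_L]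
      have hη : (F.L : ℝ) ^ n * (F.P K).eta n = 1 := by have := B12Eq115BackgroundPair.pow_mul_eta (F.P K) n; rwa [T4Family.P_L] at this
      have hηpos : 0 < (F.P K).eta n := B3GkZeroTorusRescaled.eta_pos (F.P K) n
      have hW : (2 * ((4 : ℕ) * ((F.L : ℝ) ^ n * ((M₀ + 11 * 4 + F.L : ℕ) : ℝ) - 1)) + 1) * (F.P K).eta n ≤ 8 * ((M₀ + 11 * 4 + F.L : ℕ) : ℝ) := by
        have : (2 * ((4 : ℕ) * ((F.L : ℝ) ^ n * ((M₀ + 11 * 4 + F.L : ℕ) : ℝ) - 1)) + 1) * (F.P K).eta n =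
            8 * ((M₀ + 11 * 4 + F.L : ℕ) : ℝ) * ((F.L : ℝ) ^ n * (F.P K).eta n) - 7 * (F.P K).eta n := by push_cast; ring
        rw [this, hη, mul_one]; linarith
      have hr : 7 * (4 : ℕ) * (F.L : ℝ) ^ 2 * B₁ * ((M₀ + 11 * 4 + F.L : ℕ) : ℝ) * ((F.L : ℝ) ^ 3 * ε (n - 1)) ≤ 28 * (F.L : ℝ) ^ 5 * B₁ * M₂ * a0Of F N M B₁ c₁ := by
        have : 7 * (4 : ℕ) * (F.L : ℝ) ^ 2 * B₁ * ((M₀ + 11 * 4 + F.L : ℕ) : ℝ) * ((F.L : ℝ) ^ 3 * ε (n - 1)) =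
            28 * (F.L : ℝ) ^ 5 * B₁ * ((M₀ + 11 * 4 + F.L : ℕ) : ℝ) * ε (n - 1) := by push_cast; ring
        rw [this]; gcongr
      set X : ℝ := 8 * (M₂ : ℝ) * N * (28 * (F.L : ℝ) ^ 5 * B₁ * M₂) with hX
      have hX0 : 0 ≤ X := by positivity
      have hXa : X * a0Of F N M B₁ c₁ < 1 := by
        calc X * a0Of F N M B₁ c₁ ≤ X * (1 / (X + 1)) := mul_le_mul_of_nonneg_left ha₀w hX0
          _ < 1 := by rw [mul_one_div, div_lt_one (by positivity)]; linarith
      calc (2 * ((4 : ℕ) * ((F.L : ℝ) ^ n * ((M₀ + 11 * 4 + F.L : ℕ) : ℝ) - 1)) + 1) *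
            ((F.P K).eta n * N * (7 * (4 : ℕ) * (F.L : ℝ) ^ 2 * B₁ * ((M₀ + 11 * 4 + F.L : ℕ) : ℝ) * ((F.L : ℝ) ^ 3 * ε (n - 1))))
          = ((2 * ((4 : ℕ) * ((F.L : ℝ) ^ n * ((M₀ + 11 * 4 + F.L : ℕ) : ℝ) - 1)) + 1) * (F.P K).eta n) *
            (N * (7 * (4 : ℕ) * (F.L : ℝ) ^ 2 * B₁ * ((M₀ + 11 * 4 + F.L : ℕ) : ℝ) * ((F.L : ℝ) ^ 3 * ε (n - 1)))) := by ring
        _ ≤ (8 * ((M₀ + 11 * 4 + F.L : ℕ) : ℝ)) * (N * (28 * (F.L : ℝ) ^ 5 * B₁ * M₂ * a0Of F N M B₁ c₁)) := by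
            gcongr
        _ ≤ (8 * (M₂ : ℝ)) * (N * (28 * (F.L : ℝ) ^ 5 * B₁ * M₂ * a0Of F N M B₁ c₁)) := by gcongr
        _ = X * a0Of F N M B₁ c₁ := by rw [hX]; ring
        _ < 1 := hXa
        _ < 2 * Real.pi := by linarith [Real.pi_gt_three]
    obtain ⟨u, A, h1, h2, h3, h4⟩ := exists_localGauge10_cube_of_prop6 (P := F.P K) hd hB₁ hP6 U h17 h19 hn1 (by omega) hεn1 a hSN₀ hcollar hc₁' h2π
    -- the letters at `B₉·ε_n`
    have hbound : 2 * (7 * (F.P K).d * ((F.P K).L : ℝ) ^ 2 * B₁ * (propCube (F.P K) n hn1 M₀ a).M * (((F.P K).L : ℝ) ^ 3 * ε (n - 1))) <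
        b9Of F M B₁ * ε n := by
      rw [propCube_M, T4Family.P_d, T4Family.P_L, b9Of]
      have : 2 * (7 * (4 : ℕ) * (F.L : ℝ) ^ 2 * B₁ * ((M₀ + 11 * 4 + F.L : ℕ) : ℝ) * ((F.L : ℝ) ^ 3 * ε (n - 1))) =
          56 * (F.L : ℝ) ^ 5 * B₁ * ((M₀ + 11 * 4 + F.L : ℕ) : ℝ) * ε (n - 1) := by push_cast; ring
      rw [this]
      calc 56 * (F.L : ℝ) ^ 5 * B₁ * ((M₀ + 11 * 4 + F.L : ℕ) : ℝ) * ε (n - 1) ≤ 56 * (F.L : ℝ) ^ 5 * B₁ * M₂ * (2 * ε n) := by gcongr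
        _ = (112 * (F.L : ℝ) ^ 5 * B₁ * M₂) * ε n := by ring
        _ < (112 * (F.L : ℝ) ^ 5 * B₁ * ((F.L * M + 44 + F.L : ℕ) : ℝ) + 1) * ε n := by
            rw [hM₂]; exact mul_lt_mul_of_pos_right (lt_add_one _) hεn
    exact ⟨u, A, h1, fun b hb => (h2 b hb).trans_lt hbound, fun q hq => (h3 q hq).trans_lt hbound, fun b hb => (h4 b hb).trans_lt hbound⟩
  -- the two families
  rcases hS with rfl | rfl
  · exact key M hMpos (by rw [hM₂]; nlinarith [(F.P 0).L_pos]) hSN hΩ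
  · have hside : side (F.P K).L M (n + 1) = side (F.P K).L ((F.P K).L * M) n := by simp only [side, pow_succ]; ring
    rw [hside] at hSN hΩ ⊢
    exact key ((F.P K).L * M) (Nat.one_le_iff_ne_zero.2 (Nat.mul_ne_zero (F.P K).L_pos.ne' hMpos.ne')) (by rw [hM₂, T4Family.P_L]) hSN hΩ

end Wrapper

/-! ## §3  ★ The token ⇒ BOTH members of the class (2) on every grid cube ([6] Thm 2's gauge read back through [15] (168) ∕ [6] (1.54)) -/

section ReadBack

variable {F : T4Family} {N : ℕ} [NeZero N]

/-- `0 < η_n ≤ 1` on the lattices of record (`η_n = L^{−n}`, `L ≥ 1`). [cite: Balaban1987RG1, (1.1) p.260 (bookkeeping)] -/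
private theorem eta_pos_le_one' (P : Params) (n : ℕ) : 0 < P.eta n ∧ P.eta n ≤ 1 := by
  have hL : (1 : ℝ) ≤ P.L := by exact_mod_cast P.L_pos
  unfold Params.eta
  exact ⟨pow_pos (inv_pos.mpr (lt_of_lt_of_le one_pos hL)) n, pow_le_one₀ (inv_nonneg.mpr (zero_le_one.trans hL)) (inv_le_one_of_one_le₀ hL)⟩

/-- ★ **THE (152)-TOKEN WITH THE SECOND-ORDER LETTER RETURNS BOTH MEMBERS OF THE CLASS (2) ON EVERY GRID CUBE**: under the binders of `Gauge152OfClassTopStepR10 F N Sup M c B₉ a₀`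
(a class member `U` on a separated index with the floor `c ≤ ν.M₁`), on every non-wrapping grid cube `□ ⊆ Ω_n` of the two families, whenever `32·d·B₉ε_n ≤ 1`:
`PlaqSmallOn (plaqInside □) (32·B₉ε_n·η_n²) U` (module 31: (1.7) from `|A|, |∇A|`) AND `Sect2.CoDivSmallOn (bondsDeep □) (2·B₉ε_n·η_n³) U` (33c: (1.9) from `|A|, |∇A|, |∂*∂A|`) —
[6] Thm 2 ∕ Prop. 6's gauge, read back through [15] (168) ∕ [6] (1.54), gives print's class (2) again on the cube, both members, up to the constants.  The token stays a
HYPOTHESIS. [cite: Balaban1985Variational, (152) p.301, (168) p.304, (2) p.278; Balaban1985RegularSpaces, Thm 2 (1.36) p.82, Prop. 7 (1.140)–(1.144) p.100, (1.54) p.85] -/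
theorem regularTwo_cube_of_gauge152R10 {Sup : (ν : Stage7Numerics) → (K : ℕ) → (ℕ → Set (Site (F.P K) 0)) → Set (Site (F.P K) 0)} {M c : ℕ} {B₉ a₀ : ℝ}
    (h : Gauge152OfClassTopStepR10 F N Sup M c B₉ a₀) (ν : Stage7Numerics) (g : ℕ → ℝ) (K k : ℕ) (s : SeqOfRecord F ν M g K k)
    (hsep : Sect2.SeqSeparated ν.M₁ s) (hM₁ : 0 < ν.M₁) (hc : c ≤ ν.M₁) (hk : 1 ≤ k) (ε : ℕ → ℝ)
    (hε : ∀ m, m ≤ k → 0 < ε m ∧ ε m ≤ a₀) (hcomp : ∀ m, m < k → ε m ≤ 2 * ε (m + 1)) (hcomp' : ∀ m, m < k → ε (m + 1) ≤ 2 * ε m)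
    (U : GaugeField (F.P K) 0 (SU N))
    (hP : ∀ m, m ≤ k → PlaqSmallOn (Sect2.omegaPlaqsTop s.Ω (Sup ν K s.Ω) m) (ε m * (F.P K).eta m ^ 2) U)
    (hD : ∀ m, m ≤ k → Sect2.CoDivSmallOn (Sect2.omegaBondsTop s.Ω (Sup ν K s.Ω) m) (ε m * (F.P K).eta m ^ 3) U)
    {n : ℕ} (hn1 : 1 ≤ n) (hnk : n ≤ k) {S : ℕ}
    (hS : S = B14.Eq213MaximalDomains.side (F.P K).L M n ∨ S = B14.Eq213MaximalDomains.side (F.P K).L M (n + 1)) (hSN : (S : ℤ) < (F.P K).sitesPerDir 0)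
    {a : Fin (F.P K).d → ℤ} (ha : a ∈ cubeIndices (F.P K) S) (hΩ : cubeEnl (F.P K) S a 0 ⊆ s.Ω n) (hsmall : 32 * (F.P K).d * (B₉ * ε n) ≤ 1) :
    PlaqSmallOn (plaqInside (cubeEnl (F.P K) S a 0)) (32 * (B₉ * ε n) * (F.P K).eta n ^ 2) U ∧
      Sect2.CoDivSmallOn (Sect2.bondsDeep (cubeEnl (F.P K) S a 0)) (2 * (B₉ * ε n) * (F.P K).eta n ^ 3) U :=
  Sect2.regularTwo_of_localGauge10On (h ν g K k s hsep hM₁ hc hk ε hε hcomp hcomp' U hP hD n hn1 hnk S hS hSN a ha hΩ)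
    (eta_pos_le_one' (F.P K) n).1 (eta_pos_le_one' (F.P K) n).2 hsmall

end ReadBack

end Literature.MathematicalPhysics.QuantumFieldTheory.Balaban1983to89.Node00

end
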